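import Summits.CriticalPhenomena.CardyFormulaZ2.Theses.CardySelfRefinement
import Summits.CriticalPhenomena.CardyFormulaZ2.Theorems.CardySelfRefinementLagHandOffColumnArrival
import Summits.CriticalPhenomena.CardyFormulaZ2.Theorems.CardySelfRefinementLagHandOffColumnWinding
import Summits.CriticalPhenomena.CardyFormulaZ2.Theorems.CardySelfRefinementLagHandOffExplorationPrefix
import Literature.Probability.LatticeModels.CornerPermutation
import HarnessLib

/-!
# The lattice dictionary at a column cross-cut for the bond-`ℤ²` medial exploration
(groundwork for stub `stub_tournamentTransfer`, line `hitting-tournament`, crux `LagHandOff`,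
stmt-CriticalPhenomena-10268)

Registered stub: `stub_tournamentTransfer : QuadContinuity → TournamentRigidity →
LimitCurveRegularity → ∃ Ψ, IsTournamentTransfer Ψ` (namespace
`Summit.CriticalPhenomena.CardyFormulaZ2.Cruxes.LagHandOff.HittingTournament`): a decoder reading
the interface of every Dobrushin domain off the quad-crossing configuration through its
first-hitting data on cross-cuts.  Its step (a) is the LATTICE DICTIONARY "the interface first
hits the cross-cut below its division point iff there is an open crossing from the arc `A` to the
part of the cross-cut below that point" (Holden–Sun, arXiv:1905.13207, proof of Prop. 6.25,
step (1), stated there for face percolation on the hexagonal lattice).  This file proves it,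
exactly and without planar topology, for G02's medial exploration of bond percolation on `δℤ²`
(Smirnov 2001 §2, square-lattice version; `MedialInterface.lean`, `MedialInterfaceProofs.lean`)
and the cross-cuts cut out by lattice COLUMNS `{re = k}`:

* `medialExploration_first_column` — for admissible data `E` with start corner `c₀` strictly
  west of the column and an exploration that does not stay in `{re < k}`: the FIRST medial
  vertex of `medialExploration E ω` on the column is the vertical edge `{(k,j-1), (k,j)}` below a
  column site `v = (k, j)` (all earlier ones lie in `{re < k}`), reached through the south-east
  dart `((k,j), 2)` after FOLLOWING the open edge `{(k-1,j), (k,j)}`; the arrival vertex `v` is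
  joined to the `A`-end `c₀.1` of `e_a` by OPEN edges of `{re < k}` (left side), and the arrival
  face `(k-1, j-1)` to the inner face of `e_a` by a DUAL-OPEN path through inner faces `f`,
  `f 0 < k` (right side) — from `…ColumnArrival.lean`;
* `medialExploration_first_column_iff` — if moreover `e_a` lies on the OUTER boundary (its
  outer face escapes: a walk of faces crossing no edge of `Ω_δ` reaches a face at least as high
  as `Ω_δ`; the empty walk qualifies when `e_a` is on the top side), then NO column site
  strictly below `v` on the same column segment of `Ω_δ` is joined to `c₀.1` by open edges of
  `{re < k}` — from the winding-number argument of `…ColumnWinding.lean`.  So the arrival vertex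
  is the LOWEST site of its column cross-cut in the open cluster of `A` grown strictly west of
  the cross-cut: reading the cross-cut from its `A`-end, "first hit below the division point iff
  an open path from `A`, west of the cross-cut, to the part below it"
  (`medialExploration_first_column_threshold`, the location bit at a threshold height).

The first hitting POINT of the exploration polyline / of the closed half-plane east of the
column (`Curve.hitParam`, the curve surgery behind the line's `hitPoint` / `SameTournament`) is
identified in the sequel `…ColumnFirstContact.lean`.  What remains of the stub beyond this
dictionary — continuity of the bits under subsequential limits and clean first contacts, joint
tightness and regularity of sublimits, rigidity, the equivariant all-domain decoder — is the
research-level content recorded in the line card (Garban–Pete–Schramm 2013, Question 10, on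
`ℤ²` subsequential limits).

References: S. Smirnov, C. R. Acad. Sci. Paris 333 (2001), §2; G. Grimmett, *Percolation*
(1999), §11.2; N. Holden, X. Sun, arXiv:1905.13207, §6.6, Prop. 6.25.
-/

noncomputable section

open Set
open Literature.Probability.Percolation Literature.Probability.LatticeModels

namespace Summit.CriticalPhenomena.CardyFormulaZ2.Cruxes.LagHandOff.HittingTournament

/-! ### The medial exploration of admissible Dobrushin data: first arrival at a column -/

section Exploration

open Summit.CriticalPhenomena.CardyFormulaZ2.Cruxes.LagHandOff.CrosscutDictionary
  (exists_medialExploration_eq_explorationList)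

variable {E : DiscreteDobrushin} {c₀ : Site 2 × Fin 4}

/-- Entries of the cut orbit, as optional values. [cite: Smirnov2001, §2] -/
theorem getElem?_explorationList (β : BondConfig (Site 2)) (c : Site 2 × Fin 4) {N i : ℕ}
    (hi : i ≤ N) : (explorationList β c N)[i]? = some (cSrc (cornerOrbit β c i)) := by
  simp [explorationList, Nat.lt_succ_of_le hi]

/-- **The lattice dictionary at a column, part I (what is exact and topology-free).**  Let `E`
be admissible Dobrushin data with start corner `c₀` (its vertex `c₀.1` is the arc-`A` endpoint
of the boundary edge `e_a`), `ω` a configuration, `β = E.bcBondConfig ω` the completed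
configuration, and `k` a column such that the start vertex lies strictly west of it
(`c₀.1 0 < k`) while some medial vertex of the exploration does not lie in the open half-plane
`{re < k}`.  Then there are an index `τ + 2` and a site `v = (k, j)` ON the column such that:
the `(τ+2)`-nd medial vertex of `medialExploration E ω` is the vertical edge `{(k, j-1), (k, j)}`
of the column and all earlier ones lie in `{re < k}` (FIRST ARRIVAL at the column); the
exploration arrives through the south-east dart `((k, j), 2)` of the face `(k-1, j-1) + [0,1]²`,
having just FOLLOWED the open horizontal edge `{(k-1, j), (k, j)}`; the arrival vertex `(k, j)`
is joined to the `A`-end `c₀.1` of `e_a` by OPEN edges of `{re < k}` (LEFT side); and the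
arrival face `(k-1, j-1)` is joined to the inner face of `e_a` by a DUAL-OPEN path through
inner faces of `E` lying in `{re ≤ k}` (RIGHT side).  This is the input from the lattice to
the identity "first hit of the cross-cut below its point `p` iff an open crossing from the arc
`A` to the sub-arc below `p`" (Holden–Sun, arXiv:1905.13207, proof of Prop. 6.25, step (1);
here for the bond-`ℤ²` medial exploration of Smirnov 2001 §2 / Grimmett 1999 §11.2 and the
cross-cuts cut out by lattice columns); the remaining input is planar duality in the quad.
[cite: Smirnov2001, §2] -/
theorem medialExploration_first_column (hE : E.IsZdAdmissible) (hc₀ : E.IsStartCorner c₀)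
    (ω : BondConfig (Site 2)) {k : ℤ} (hwest : c₀.1 0 < k)
    (heast : ∃ e ∈ medialExploration E ω, 2 * k ≤ edgeAbs2 e) :
    ∃ (τ : ℕ) (v : Site 2), τ + 2 < (medialExploration E ω).length ∧ v 0 = k ∧
      (medialExploration E ω)[τ + 2]? = some s(v, v + cornerUnit 3) ∧
      (∀ i < τ + 2, ∀ e, (medialExploration E ω)[i]? = some e → edgeAbs2 e < 2 * k) ∧
      (medialExploration E ω)[τ + 1]? = some s(v, v + cornerUnit 2) ∧
      s(v, v + cornerUnit 2) ∈ E.bcBondConfig ω ∧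
      cornerOrbit (E.bcBondConfig ω) c₀ (τ + 1) = (v, 2) ∧
      cornerOrbit (E.bcBondConfig ω) c₀ τ = (v + cornerUnit 2, 3) ∧
      (∀ n ≤ τ + 1, E.IsInnerFace (cFace (cornerOrbit (E.bcBondConfig ω) c₀ n))) ∧
      E.bcBondConfig ω ∩ {e | edgeAbs2 e < 2 * k} ∈ openConnIn {u : Site 2 | u 0 ≤ k} c₀.1 v ∧
      dualConfig (E.bcBondConfig ω) ∈
        openConnIn {f : Site 2 | f 0 < k ∧ E.IsInnerFace f} (cFace c₀) (faceAt v 2) := by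
  classical
  obtain ⟨N, -, hinner, heq⟩ := exists_medialExploration_eq_explorationList hE hc₀ ω
  set β := E.bcBondConfig ω with hβ
  -- a medial vertex of the exploration not strictly west of the column
  obtain ⟨e, he, hke⟩ := heast
  rw [heq] at he
  obtain ⟨M, hMN, rfl⟩ : ∃ M, M ≤ N ∧ e = cSrc (cornerOrbit β c₀ M) := by
    simp only [explorationList, List.mem_map, List.mem_range] at he
    obtain ⟨M, hM, rfl⟩ := he
    exact ⟨M, by omega, rfl⟩
  have h0 : edgeAbs2 (cSrc c₀) < 2 * k := by
    rw [edgeAbs2_cSrc]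
    have := (cornerUnit_apply_zero_mem_Icc c₀.2).2
    omega
  obtain ⟨σ, hσM, hσ, hbefore⟩ := exists_first_column_index h0 hke
  -- the arrival happens at an index `σ = τ + 2`
  obtain ⟨σ', rfl⟩ : ∃ σ', σ = σ' + 1 := by
    rcases σ with _ | σ'
    · exact absurd hσ (by rw [show cornerOrbit β c₀ 0 = c₀ from rfl]; omega)
    · exact ⟨σ', rfl⟩
  obtain ⟨hv, hd⟩ := cornerOrbit_arrival hσ (hbefore σ' (Nat.lt_succ_self _))
  obtain ⟨τ, rfl⟩ : ∃ τ, σ' = τ + 1 := by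
    rcases σ' with _ | τ
    · exact absurd hv (by rw [show cornerOrbit β c₀ 0 = c₀ from rfl]; omega)
    · exact ⟨τ, rfl⟩
  obtain ⟨hopen, hprev⟩ :=
    cornerOrbit_before_arrival hσ (hbefore _ (by omega)) (hbefore _ (by omega))
  set v := (cornerOrbit β c₀ (τ + 1)).1 with hvdef
  have horb : cornerOrbit β c₀ (τ + 1) = (v, 2) := Prod.ext rfl hd
  have hlen : (medialExploration E ω).length = N + 1 := by rw [heq, length_explorationList]
  refine ⟨τ, v, by omega, hv, ?_, ?_, ?_, ?_, horb, hprev, ?_, ?_, ?_⟩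
  · rw [heq, getElem?_explorationList β c₀ (i := τ + 2) (by omega), cSrc_cornerOrbit_succ', horb]
    rfl
  · intro i hi e hie
    rw [heq, getElem?_explorationList β c₀ (i := i) (by omega), Option.some.injEq] at hie
    rw [← hie]
    exact hbefore i hi
  · rw [heq, getElem?_explorationList β c₀ (i := τ + 1) (by omega), horb]
    rfl
  · have : cTgt (cornerOrbit β c₀ τ) = s(v, v + cornerUnit 2) := by
      rw [← cSrc_cornerOrbit_succ', horb]; rfl
    rw [← this]
    exact hopen
  · intro n hn
    exact hinner n (by omega)
  · have h := openConnIn_left_cornerOrbit_column hbefore (n := τ + 1) (by omega)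
    rwa [horb] at h
  · have h := openConnIn_right_cornerOrbit (β := β) (c₀ := c₀)
      {f : Site 2 | f 0 < k ∧ E.IsInnerFace f} Set.univ (τ + 1)
      (fun m hm => ⟨cFace_apply_zero_lt_of_edgeAbs2_cSrc_lt (hbefore m (by omega)),
        hinner m (by omega)⟩) (fun _ _ _ => Set.mem_univ _)
    rwa [Set.inter_univ, horb] at h

end Exploration

/-! ### The exact dictionary for admissible data whose edge `e_a` lies on the outer boundary -/

section Dictionary

variable {E : DiscreteDobrushin} {c₀ : Site 2 × Fin 4}

/-- **The lattice dictionary at a column cross-cut, exact form.**  Let `E` be admissible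
Dobrushin data with start corner `c₀` strictly west of the column `{re = k}`, whose boundary
edge `e_a` lies on the OUTER boundary in the following combinatorial sense: from the outer
(non-inner) face `o` of `e_a` a walk of faces crossing no edge of `Ω_δ` reaches a face `uTop` at
least as high as `Ω_δ` (for `e_a` on the top side of `Ω_δ` the empty walk at `o` qualifies).
If the exploration does not stay in `{re < k}`, let `v = (k, j)` be its arrival vertex at the
column (`medialExploration_first_column`).  Then `v` is joined to the `A`-end `c₀.1` of `e_a` by
open edges of `{re < k}`, and NO site `w` of the column strictly below `v` and on the same
column segment of `Ω_δ` (the column edges between `w` and `v` are edges of `Ω_δ`) is so joined: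
the arrival vertex is the LOWEST site of its column cross-cut in the open cluster of `A` grown
strictly west of the cross-cut.  With the cross-cut read from its `A`-end (top) this is
"first hit below the division point iff an open crossing from `A` to the part below it"
(Holden–Sun, arXiv:1905.13207, proof of Prop. 6.25, step (1)), here for the bond-`ℤ²` medial
exploration of Smirnov 2001 §2 and lattice columns. [cite: Smirnov2001, §2] -/
theorem medialExploration_first_column_iff (hE : E.IsZdAdmissible) (hc₀ : E.IsStartCorner c₀)
    (ω : BondConfig (Site 2)) {k : ℤ} (hwest : c₀.1 0 < k)
    (heast : ∃ e ∈ medialExploration E ω, 2 * k ≤ edgeAbs2 e) {uTop : Site 2}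
    (ε : (zdGraph 2).Walk (faceAt c₀.1 (c₀.2 + 3)) uTop)
    (hε : ∀ d ∈ ε.darts, sepEdge d.fst d.snd ∉ (discreteDomainGraph E.Ω E.δ).edgeSet)
    (htop : ∀ z ∈ meshDomain E.Ω E.δ, z 1 ≤ uTop 1) :
    ∃ (τ : ℕ) (v : Site 2), τ + 2 < (medialExploration E ω).length ∧ v 0 = k ∧
      (medialExploration E ω)[τ + 2]? = some s(v, v + cornerUnit 3) ∧
      (∀ i < τ + 2, ∀ e, (medialExploration E ω)[i]? = some e → edgeAbs2 e < 2 * k) ∧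
      E.bcBondConfig ω ∩ {e | edgeAbs2 e < 2 * k} ∈ openConnIn {u : Site 2 | u 0 ≤ k} c₀.1 v ∧
      ∀ w : Site 2, w 0 = k → w 1 < v 1 →
        (∀ z : Site 2, z 0 = k → w 1 ≤ z 1 → z 1 < v 1 →
          (discreteDomainGraph E.Ω E.δ).Adj z (z + Pi.single 1 1)) →
        ∀ S : Set (Site 2), E.bcBondConfig ω ∩ {e | edgeAbs2 e < 2 * k} ∉ openConnIn S c₀.1 w := by
  obtain ⟨τ, v, hlen, hv, hhit, hbefore, -, -, -, -, -, hleft, hright⟩ :=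
    medialExploration_first_column hE hc₀ ω hwest heast
  refine ⟨τ, v, hlen, hv, hhit, hbefore, hleft, fun w hw hwv hcol S hPi => ?_⟩
  set β := E.bcBondConfig ω with hβ
  set G := discreteDomainGraph E.Ω E.δ with hG
  have hGle : G ≤ zdGraph 2 :=
    (discreteDomainGraph_le_meshGraph _ _).trans (meshGraph_le_zdGraph _ _)
  -- the start edge `e_a`: closed, strictly west, separating the inner face `f₀` from `o`
  have h0 : edgeAbs2 (cSrc c₀) < 2 * k := by
    rw [edgeAbs2_cSrc]
    have := (cornerUnit_apply_zero_mem_Icc c₀.2).2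
    omega
  have hea : cSrc c₀ ∉ β := cSrc_start_not_mem hE hc₀
  have hadj : (zdGraph 2).Adj (cFace c₀) (faceAt c₀.1 (c₀.2 + 3)) := by
    have h := adj_faceAt_succ c₀.1 (c₀.2 + 3)
    rw [fin4_add_three_add_one] at h
    exact h.symm
  -- the dual edge of the source edge `e_a` joins the outer face `o` to the inner face `f₀`
  have hdualEdge : dualEdge (cSrc c₀) = s(faceAt c₀.1 (c₀.2 + 3), faceAt c₀.1 c₀.2) := by
    have h := dualEdge_cTgt c₀.1 (c₀.2 + 3)
    rwa [fin4_add_three_add_one, show cTgt (c₀.1, c₀.2 + 3) = cSrc c₀ by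
      simp only [cTgt, cSrc, fin4_add_three_add_one]] at h
  have hdual : s(cFace c₀, faceAt c₀.1 (c₀.2 + 3)) ∈ dualConfig β :=
    mem_dualConfig_of_dualEdge_eq (cSrc_mem_edgeSet _) hea hadj (by rw [hdualEdge, Sym2.eq_swap]; rfl)
  have ho₀ : faceAt c₀.1 (c₀.2 + 3) 0 < k :=
    cFace_apply_zero_lt_of_edgeAbs2_cSrc_lt (p := (c₀.1, c₀.2 + 3)) (by
      rw [edgeAbs2_cSrc]
      have := (cornerUnit_apply_zero_mem_Icc (c₀.2 + 3)).2
      simp only at this ⊢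
      omega)
  refine not_openConnIn_below_of_arrival (E.bcBondConfig_subset ω) hGle hv hw hwv hleft
    (openConnIn_mono (fun f hf => hf.1) _ _ hright) hadj
    (Z2HalfPlane.sepEdge_notMem_of_mem_dualConfig hadj hdual)
    (edgeAbs2_sepEdge_lt hadj (cFace_apply_zero_lt_of_edgeAbs2_cSrc_lt h0) ho₀) ε hε
    (fun e he z hz => ?_) (fun z hz0 hz1 hz2 => (hcol z hz0 hz1 hz2)) hPi
  -- endpoints of edges of `Ω_δ` are sites of `Ω_δ`
  induction e using Sym2.ind with
  | h x y =>
    have hxy := discreteDomainGraph_adj_iff.1 he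
    rcases Sym2.mem_iff.1 hz with rfl | rfl
    · exact htop _ hxy.2.1
    · exact htop _ hxy.2.2

/-- **Location bit, threshold form.** In the situation of `medialExploration_first_column_iff`,
for a column segment of `Ω_δ` reaching down to height `j₀ ≤ j` below the arrival vertex
`v = (k, j)` and a threshold `m ≥ j₀`: SOME site of the segment at height `≤ m` is joined to the
`A`-end of `e_a` by open edges of `{re < k}` IFF the arrival height is `≤ m` ("first hit below the
division point iff an open crossing from `A` to the part below it", Holden–Sun Prop. 6.25 (1)).
[cite: Smirnov2001, §2] -/
theorem medialExploration_first_column_threshold (hE : E.IsZdAdmissible)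
    (hc₀ : E.IsStartCorner c₀) (ω : BondConfig (Site 2)) {k : ℤ} (hwest : c₀.1 0 < k)
    (heast : ∃ e ∈ medialExploration E ω, 2 * k ≤ edgeAbs2 e) {uTop : Site 2}
    (ε : (zdGraph 2).Walk (faceAt c₀.1 (c₀.2 + 3)) uTop)
    (hε : ∀ d ∈ ε.darts, sepEdge d.fst d.snd ∉ (discreteDomainGraph E.Ω E.δ).edgeSet)
    (htop : ∀ z ∈ meshDomain E.Ω E.δ, z 1 ≤ uTop 1) :
    ∃ (τ : ℕ) (v : Site 2), τ + 2 < (medialExploration E ω).length ∧ v 0 = k ∧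
      (medialExploration E ω)[τ + 2]? = some s(v, v + cornerUnit 3) ∧
      (∀ i < τ + 2, ∀ e, (medialExploration E ω)[i]? = some e → edgeAbs2 e < 2 * k) ∧
      ∀ j₀ m : ℤ, j₀ ≤ v 1 → j₀ ≤ m →
        (∀ z : Site 2, z 0 = k → j₀ ≤ z 1 → z 1 < v 1 →
          (discreteDomainGraph E.Ω E.δ).Adj z (z + Pi.single 1 1)) →
        ((∃ w : Site 2, w 0 = k ∧ j₀ ≤ w 1 ∧ w 1 ≤ m ∧ ∃ S : Set (Site 2),
            E.bcBondConfig ω ∩ {e | edgeAbs2 e < 2 * k} ∈ openConnIn S c₀.1 w) ↔ v 1 ≤ m) := by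
  obtain ⟨τ, v, hlen, hv, hhit, hbefore, hleft, hmin⟩ :=
    medialExploration_first_column_iff hE hc₀ ω hwest heast ε hε htop
  refine ⟨τ, v, hlen, hv, hhit, hbefore, fun j₀ m hj₀ hj₀m hseg => ⟨?_, fun hvm => ?_⟩⟩
  · rintro ⟨w, hw, hjw, hwm, S, hS⟩
    by_contra hlt
    exact hmin w hw (by omega) (fun z hz0 hz1 hz2 => hseg z hz0 (le_trans hjw hz1) hz2) S hS
  · exact ⟨v, hv, hj₀, hvm, _, hleft⟩

/-- **Registered sub-goal stub `stub_tournamentTransfer_columnDictionary`** (tree vocabulary; =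
`medialExploration_first_column_iff`). [cite: Smirnov2001, §2] -/
theorem stub_tournamentTransfer_columnDictionary : ∀ (E : DiscreteDobrushin) (c₀ : Site 2 × Fin 4) (ω : BondConfig (Site 2)) (k : ℤ) (uTop : Site 2) (ε : (zdGraph 2).Walk (faceAt c₀.1 (c₀.2 + 3)) uTop), E.IsZdAdmissible → E.IsStartCorner c₀ → c₀.1 0 < k → (∃ e ∈ medialExploration E ω, ∀ x y : Site 2, e = s(x, y) → 2 * k ≤ x 0 + y 0) → (∀ d ∈ ε.darts, sepEdge d.fst d.snd ∉ (discreteDomainGraph E.Ω E.δ).edgeSet) → (∀ z ∈ meshDomain E.Ω E.δ, z 1 ≤ uTop 1) → ∃ (τ : ℕ) (v : Site 2), τ + 2 < (medialExploration E ω).length ∧ v 0 = k ∧ (medialExploration E ω)[τ + 2]? = some s(v, v + cornerUnit 3) ∧ (∀ i < τ + 2, ∀ x y : Site 2, (medialExploration E ω)[i]? = some s(x, y) → x 0 + y 0 < 2 * k) ∧ E.bcBondConfig ω ∩ {e | ∀ x y : Site 2, e = s(x, y) → x 0 + y 0 < 2 * k} ∈ openConnIn {u : Site 2 | u 0 ≤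 k} c₀.1 v ∧ ∀ w : Site 2, w 0 = k → w 1 < v 1 → (∀ z : Site 2, z 0 = k → w 1 ≤ z 1 → z 1 < v 1 → (discreteDomainGraph E.Ω E.δ).Adj z (z + Pi.single 1 1)) → ∀ S : Set (Site 2), E.bcBondConfig ω ∩ {e | ∀ x y : Site 2, e = s(x, y) → x 0 + y 0 < 2 * k} ∉ openConnIn S c₀.1 w := by
  intro E c₀ ω k uTop ε hE hc₀ hwest heast hε htop
  have heast' : ∃ e ∈ medialExploration E ω, 2 * k ≤ edgeAbs2 e := by
    obtain ⟨e, he, hke⟩ := heast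
    exact ⟨e, he, (forall_eq_mk_iff e (2 * k ≤ ·)).1 hke⟩
  obtain ⟨τ, v, hlen, hv, hhit, hbefore, hleft, hmin⟩ :=
    medialExploration_first_column_iff hE hc₀ ω hwest heast' ε hε htop
  rw [← setOf_forall_eq_mk_lt] at hleft hmin
  refine ⟨τ, v, hlen, hv, hhit, fun i hi x y hxy => ?_, hleft, hmin⟩
  exact hbefore i hi _ hxy

end Dictionary

end Summit.CriticalPhenomena.CardyFormulaZ2.Cruxes.LagHandOff.HittingTournament

end
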